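import Mathlib
import Summits.NavierStokesRegularity.NavierStokesRegularity.Theorems.TaoLadderRungTwoFlatGappedFrontRobustDeviationOn
import HarnessLib

/-!
# Shift-set pseudo-flows: THE ROW-SUM CONSTANT `Γ` of the active-zone comparison on a nearest-neighbour `𝕊`
  (three regions: behind / front block / hand-over; helper for item stmt-NavierStokesRegularity-22988
  `GappedFrontRobustV2Flat`, crux K_B♭ of route TaoLadderRungTwoFlat)

The `𝕊`-parametrised version of `Theorems/TaoLadderRungThreeGappedFrontRobustRowSum.lean` (p1 g10, one-way
`S`). The active zone on `𝕊` (`pseudoFlowOnShift_active_zone`) asks for ONE constant `Γ` with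
`∑_{i₁,i₂,μ∈𝕊} |α| q^{5(n−μ₃)/2} (D_a A_b + A_a D_b) ≤ Γ D n` on the compared shells (`D k = r / w(k−1)`,
`A = A⁰ + 2 P D`). The `S` proof only ever bounds `A` and `D` on the THREE shells `n−1, n, n+1` through
`rowSum_le_of_le`; its `𝕊`-twin `rowSumOn_le_of_le` (p1 g11) has the same shape, so the three-region
argument (behind: rates `q^{5n/2}` against `q^{−2n}` growth via `TameBehind`; block: finitely many shells;
hand-over: exactly the H4b quantity) goes through VERBATIM on any nearest-neighbour shift set — the
backscatter classes only change the count `∑|α| ≤ m·m·|𝕊|` (`sum_abs_coeffOn_le`). Result: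
`rowSumOn_le_gamma` with `Γ = 2 (m·m·|𝕊|) ((C_A + 2r) C_T q³ + q^{5(kt+2)/2} (A_mid + 2r) W + (A_hi + 2) C₄) + 1`.

HONEST FRAMING: elementary real-number bookkeeping (the bilinear row sums of Tao 2016 §4 (4.8) against the
weights of a v2 gap certificate); nothing is asserted about any table or flow; nothing here concerns the
Navier–Stokes equations (p1 g12).
-/

noncomputable section

-- the sub-problem namespace `Summit.NavierStokesRegularity.NavierStokesRegularity` repeats the summit name by design (D-0017)
set_option linter.dupNamespace false

namespace Summit.NavierStokesRegularity.NavierStokesRegularity.Theorems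

open Set Literature.Analysis.FluidPDE Literature.Analysis.FluidPDE.TaoCascade

namespace GappedFrontRobustOn

variable {m : ℕ} {𝕊 : Finset (ℤ × ℤ × ℤ)}

set_option maxHeartbeats 400000 in
/-- **THE ROW-SUM CONSTANT on a nearest-neighbour `𝕊`.** See the module docstring: with `q = 1+ε₀ > 1`, `|α| ≤ 1` on `𝕊`,
`w ≥ 1`, `w k ≤ C_T q^{−k}` (`k ≤ 0`), (T1) and H4b from `k₁ ≥ 1`, `k₁ ≤ kt`, `kb ≤ −1`, `D k = r/w(k−1)`,
`0 ≤ A⁰`, `A⁰ k ≤ C_A q^{−k}` (`k ≤ kb+2`), `A⁰ k ≤ A_mid` (`kb+1 ≤ k ≤ kt+3`), `A⁰ k ≤ A_hi r/w(k−1)`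
(`k ≥ kt+1`), `w ≤ W` on `[kb+1, kt+1]`, `0 ≤ P ≤ 1`: for every mode `i` and EVERY shell `n` the row sum with
`A = A⁰ + 2 P D` is at most `Γ · D n`,
`Γ = 2 (m·m·|𝕊|) ((C_A + 2r) C_T q³ + q^{5(kt+2)/2} (A_mid + 2r) W + (A_hi + 2) C₄) + 1`.
[cite: Tao2016AveragedNS, §4 (4.8) (the bilinear term); §6.2 Prop. 6.3 (viii)–(ix) (statement shape)] -/
theorem rowSumOn_le_gamma (h𝕊 : IsNearestNeighbourSet 𝕊) {ε₀ : ℝ} (hε : 0 < ε₀)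
    {α : Fin m → Fin m → Fin m → ℤ × ℤ × ℤ → ℝ}
    (hα1 : ∀ (i₁ i₂ i₃ : Fin m) (μ : ℤ × ℤ × ℤ), μ ∈ 𝕊 → |α i₁ i₂ i₃ μ| ≤ 1)
    {w : ℤ → ℝ} (hw1 : ∀ k, 1 ≤ w k) {C_T : ℝ} (hCT : 0 < C_T)
    (hwT : ∀ k : ℤ, k ≤ 0 → w k ≤ C_T * (1 + ε₀) ^ (-(k : ℝ)))
    {k₁ kb kt : ℤ} (hk₁ : 1 ≤ k₁) (hkt : k₁ ≤ kt) (hkb : kb ≤ -1)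
    (hT1 : ∀ k : ℤ, k₁ ≤ k → 2 * (1 + ε₀) ^ (k : ℝ) * w k ≤ w (k + 1))
    {r C₄ : ℝ} (hr : 0 < r) (hC₄ : 0 ≤ C₄)
    (hH4b : ∀ k : ℤ, k₁ ≤ k → (1 + ε₀) ^ ((5 : ℝ) * (k + 2) / 2) * r * w (k + 1) ≤ C₄ * w k ^ 2)
    {D A₀ : ℤ → ℝ} (hD : ∀ k, D k = r / w (k - 1)) (hA0 : ∀ k, 0 ≤ A₀ k)
    {C_A A_mid A_hi W P : ℝ} (hCA : 0 ≤ C_A) (hAmid : 0 ≤ A_mid) (hAhi : 0 ≤ A_hi) (hW0 : 0 < W)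
    (hA_lo : ∀ k : ℤ, k ≤ kb + 2 → A₀ k ≤ C_A * (1 + ε₀) ^ (-(k : ℝ)))
    (hA_mid : ∀ k : ℤ, kb + 1 ≤ k → k ≤ kt + 3 → A₀ k ≤ A_mid)
    (hA_hi : ∀ k : ℤ, kt + 1 ≤ k → A₀ k ≤ A_hi * (r / w (k - 1)))
    (hW : ∀ j : ℤ, kb + 1 ≤ j → j ≤ kt + 1 → w j ≤ W) (hP0 : 0 ≤ P) (hP1 : P ≤ 1) (i : Fin m) (n : ℤ) :
    ∑ i₁, ∑ i₂, ∑ μ ∈ 𝕊, |α i₁ i₂ i μ| * (1 + ε₀) ^ ((5 : ℝ) * (n - μ.2.2) / 2) *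
        (D (n - μ.2.2 + μ.1) * (A₀ (n - μ.2.2 + μ.2.1) + 2 * P * D (n - μ.2.2 + μ.2.1)) +
          (A₀ (n - μ.2.2 + μ.1) + 2 * P * D (n - μ.2.2 + μ.1)) * D (n - μ.2.2 + μ.2.1)) ≤
      (2 * ((m : ℝ) * m * 𝕊.card) * ((C_A + 2 * r) * C_T * (1 + ε₀) ^ (3 : ℝ) +
          (1 + ε₀) ^ ((5 : ℝ) * ((kt + 2 : ℤ) : ℝ) / 2) * (A_mid + 2 * r) * W + (A_hi + 2) * C₄) + 1) *
        D n := by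
  have hq : 0 < 1 + ε₀ := by linarith
  have hq1 : 1 ≤ 1 + ε₀ := by linarith
  set q : ℝ := 1 + ε₀ with hqdef
  have hw : ∀ k, 0 < w k := fun k => lt_of_lt_of_le one_pos (hw1 k)
  have hD0 : ∀ k, 0 ≤ D k := fun k => by rw [hD k]; exact div_nonneg hr.le (hw _).le
  have hDr : ∀ k, D k ≤ r := fun k => by
    rw [hD k]; exact div_le_self hr.le (hw1 _)
  set Cα : ℝ := ∑ i₁ : Fin m, ∑ i₂ : Fin m, ∑ μ ∈ 𝕊, |α i₁ i₂ i μ| with hCα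
  have hCα0 : 0 ≤ Cα := Finset.sum_nonneg fun _ _ => Finset.sum_nonneg fun _ _ =>
    Finset.sum_nonneg fun _ _ => abs_nonneg _
  have hCα1 : Cα ≤ (m : ℝ) * m * 𝕊.card := sum_abs_coeffOn_le hα1 i
  -- the amplitude envelope A = A⁰ + 2 P D ≥ 0
  set A : ℤ → ℝ := fun k => A₀ k + 2 * P * D k with hA
  have hA0' : ∀ k, 0 ≤ A k := fun k => by
    simp only [hA]; have := hA0 k; have := hD0 k; positivity
  have hAle : ∀ k, A k ≤ A₀ k + 2 * D k := fun k => by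
    simp only [hA]; have := hD0 k; nlinarith
  -- the three Γ pieces
  set Γa : ℝ := (C_A + 2 * r) * C_T * q ^ (3 : ℝ) with hΓa
  set Γb : ℝ := q ^ ((5 : ℝ) * ((kt + 2 : ℤ) : ℝ) / 2) * (A_mid + 2 * r) * W with hΓb
  set Γc : ℝ := (A_hi + 2) * C₄ with hΓc
  have hΓa0 : 0 ≤ Γa := by have := Real.rpow_pos_of_pos hq (3 : ℝ); positivity
  have hΓb0 : 0 ≤ Γb := by
    have := Real.rpow_pos_of_pos hq ((5 : ℝ) * ((kt + 2 : ℤ) : ℝ) / 2); positivity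
  have hΓc0 : 0 ≤ Γc := by positivity
  have hm4 : 0 ≤ (m : ℝ) * m * 𝕊.card := by positivity
  have h5n : 0 ≤ q ^ ((5 : ℝ) * n / 2) := (Real.rpow_pos_of_pos hq _).le
  -- generic step: from `q^{5n/2} Amax Dmax ≤ Γx · D n` on the three shells to the claim
  have finish : ∀ {Amax Dmax Γx : ℝ}, 0 ≤ Γx → Γx ≤ Γa + Γb + Γc →
      (∀ k, n - 1 ≤ k → k ≤ n + 1 → A k ≤ Amax) → (∀ k, n - 1 ≤ k → k ≤ n + 1 → D k ≤ Dmax) →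
      q ^ ((5 : ℝ) * n / 2) * Amax * Dmax ≤ Γx * D n →
      ∑ i₁, ∑ i₂, ∑ μ ∈ 𝕊, |α i₁ i₂ i μ| * q ^ ((5 : ℝ) * (n - μ.2.2) / 2) *
          (D (n - μ.2.2 + μ.1) * (A₀ (n - μ.2.2 + μ.2.1) + 2 * P * D (n - μ.2.2 + μ.2.1)) +
            (A₀ (n - μ.2.2 + μ.1) + 2 * P * D (n - μ.2.2 + μ.1)) * D (n - μ.2.2 + μ.2.1)) ≤
        (2 * ((m : ℝ) * m * 𝕊.card) * (Γa + Γb + Γc) + 1) * D n := by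
    intro Amax Dmax Γx hΓx0 hΓx hA3 hD3 hkey
    have h1 := rowSumOn_le_of_le h𝕊 hε.le α i n (A := A) (D := D) hA0' hD0 hA3 hD3
    have hDn := hD0 n
    calc _ = ∑ i₁, ∑ i₂, ∑ μ ∈ 𝕊, |α i₁ i₂ i μ| * q ^ ((5 : ℝ) * (n - μ.2.2) / 2) *
          (D (n - μ.2.2 + μ.1) * A (n - μ.2.2 + μ.2.1) + A (n - μ.2.2 + μ.1) * D (n - μ.2.2 + μ.2.1)) := by
          simp only [hA]
      _ ≤ 2 * Cα * q ^ ((5 : ℝ) * n / 2) * Amax * Dmax := h1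
      _ = 2 * Cα * (q ^ ((5 : ℝ) * n / 2) * Amax * Dmax) := by ring
      _ ≤ 2 * Cα * (Γx * D n) := mul_le_mul_of_nonneg_left hkey (by positivity)
      _ ≤ 2 * ((m : ℝ) * m * 𝕊.card) * ((Γa + Γb + Γc) * D n) := by
          have : Γx * D n ≤ (Γa + Γb + Γc) * D n := mul_le_mul_of_nonneg_right hΓx hDn
          have : 0 ≤ Γx * D n := mul_nonneg hΓx0 hDn
          nlinarith
      _ ≤ (2 * ((m : ℝ) * m * 𝕊.card) * (Γa + Γb + Γc) + 1) * D n := by nlinarith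
  -- which region?
  rcases le_or_gt n (kb + 1) with hn | hn
  · -- (a) BEHIND: n ≤ kb + 1 ≤ 0
    have hn0 : n ≤ 0 := by linarith
    have hnr : (n : ℝ) ≤ 0 := by exact_mod_cast hn0
    have hq1n : (1 : ℝ) ≤ q ^ ((1 : ℝ) - n) := Real.one_le_rpow hq1 (by linarith)
    refine finish (Amax := (C_A + 2 * r) * q ^ ((1 : ℝ) - n)) (Dmax := r) (Γx := Γa) hΓa0
      (by linarith) ?_ (fun k _ _ => hDr k) ?_
    · intro k hk1 hk2
      have hkb2 : k ≤ kb + 2 := by linarith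
      have h1 := hA_lo k hkb2
      have h2 : q ^ (-(k : ℝ)) ≤ q ^ ((1 : ℝ) - n) :=
        Real.rpow_le_rpow_of_exponent_le hq1 (by
          have : ((n : ℝ) - 1) ≤ k := by exact_mod_cast (show n - 1 ≤ k from hk1)
          linarith)
      have h3 := hDr k
      calc A k ≤ A₀ k + 2 * D k := hAle k
        _ ≤ C_A * q ^ ((1 : ℝ) - n) + 2 * r * q ^ ((1 : ℝ) - n) := by
            have : C_A * q ^ (-(k : ℝ)) ≤ C_A * q ^ ((1 : ℝ) - n) := mul_le_mul_of_nonneg_left h2 hCA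
            nlinarith
        _ = (C_A + 2 * r) * q ^ ((1 : ℝ) - n) := by ring
    · -- q^{5n/2} (C_A+2r) q^{1-n} r ≤ Γa · D n, with D n ≥ r / (C_T q^{1-n})
      have hwn := hwT (n - 1) (by linarith)
      have hpos : 0 < C_T * q ^ ((1 : ℝ) - n) := mul_pos hCT (Real.rpow_pos_of_pos hq _)
      have hDn : r / (C_T * q ^ ((1 : ℝ) - n)) ≤ D n := by
        rw [hD n]
        have hw' : w (n - 1) ≤ C_T * q ^ ((1 : ℝ) - n) := by
          refine hwn.trans (le_of_eq ?_); push_cast; ring_nf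
        exact div_le_div_of_nonneg_left hr.le (hw _) hw'
      have hpow : q ^ ((5 : ℝ) * n / 2) * q ^ ((1 : ℝ) - n) * q ^ ((1 : ℝ) - n) = q ^ ((2 : ℝ) + n / 2) := by
        rw [← Real.rpow_add hq, ← Real.rpow_add hq]; ring_nf
      have hpow2 : q ^ ((2 : ℝ) + n / 2) ≤ q ^ (3 : ℝ) :=
        Real.rpow_le_rpow_of_exponent_le hq1 (by linarith)
      refine le_trans ?_ (mul_le_mul_of_nonneg_left hDn hΓa0)
      rw [← mul_div_assoc, le_div_iff₀ hpos]
      have hc0 : 0 ≤ (C_A + 2 * r) * C_T * r := by positivity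
      calc q ^ ((5 : ℝ) * n / 2) * ((C_A + 2 * r) * q ^ ((1 : ℝ) - n)) * r * (C_T * q ^ ((1 : ℝ) - n))
          = (C_A + 2 * r) * C_T * r * (q ^ ((5 : ℝ) * n / 2) * q ^ ((1 : ℝ) - n) * q ^ ((1 : ℝ) - n)) := by
            ring
        _ = (C_A + 2 * r) * C_T * r * q ^ ((2 : ℝ) + n / 2) := by rw [hpow]
        _ ≤ (C_A + 2 * r) * C_T * r * q ^ (3 : ℝ) := mul_le_mul_of_nonneg_left hpow2 hc0
        _ = Γa * r := by simp only [hΓa]; ring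
  rcases le_or_gt n (kt + 2) with hn' | hn'
  · -- (b) FRONT BLOCK: kb + 2 ≤ n ≤ kt + 2
    refine finish (Amax := A_mid + 2 * r) (Dmax := r) (Γx := Γb) hΓb0 (by linarith) ?_
      (fun k _ _ => hDr k) ?_
    · intro k hk1 hk2
      have h1 := hA_mid k (by linarith) (by linarith)
      have h3 := hDr k
      calc A k ≤ A₀ k + 2 * D k := hAle k
        _ ≤ A_mid + 2 * r := by linarith
    · -- q^{5n/2} (A_mid + 2r) r ≤ Γb · D n with D n ≥ r / W
      have hWn := hW (n - 1) (by linarith) (by linarith)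
      have hDn : r / W ≤ D n := by
        rw [hD n]; exact div_le_div_of_nonneg_left hr.le (hw _) hWn
      refine le_trans ?_ (mul_le_mul_of_nonneg_left hDn hΓb0)
      rw [← mul_div_assoc, le_div_iff₀ hW0]
      have hnr : (n : ℝ) ≤ ((kt + 2 : ℤ) : ℝ) := by exact_mod_cast hn'
      have hpow : q ^ ((5 : ℝ) * n / 2) ≤ q ^ ((5 : ℝ) * ((kt + 2 : ℤ) : ℝ) / 2) :=
        Real.rpow_le_rpow_of_exponent_le hq1 (by linarith)
      have hc0 : 0 ≤ (A_mid + 2 * r) * r * W := by positivity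
      calc q ^ ((5 : ℝ) * n / 2) * (A_mid + 2 * r) * r * W
          = q ^ ((5 : ℝ) * n / 2) * ((A_mid + 2 * r) * r * W) := by ring
        _ ≤ q ^ ((5 : ℝ) * ((kt + 2 : ℤ) : ℝ) / 2) * ((A_mid + 2 * r) * r * W) :=
            mul_le_mul_of_nonneg_right hpow hc0
        _ = Γb * r := by simp only [hΓb]; ring
  · -- (c) HAND-OVER: n ≥ kt + 3; the weights increase from k₁ on
    have hmono : ∀ j : ℤ, k₁ ≤ j → w j ≤ w (j + 1) := by
      intro j hj
      have h1 := hT1 j hj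
      have hj0 : (0 : ℝ) ≤ j := by exact_mod_cast (show (0 : ℤ) ≤ j by linarith)
      have h2 : (1 : ℝ) ≤ q ^ (j : ℝ) := Real.one_le_rpow hq1 hj0
      have := hw j
      nlinarith
    have hw21 : w (n - 2) ≤ w (n - 1) := by
      have := hmono (n - 2) (by linarith); rwa [show n - 2 + 1 = n - 1 by ring] at this
    have hw10 : w (n - 1) ≤ w n := by
      have := hmono (n - 1) (by linarith); rwa [show n - 1 + 1 = n by ring] at this
    have hwn2 := hw (n - 2)
    have hwn1 := hw (n - 1)
    -- on the three shells, r / w(k-1) ≤ r / w(n-2)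
    have hDk : ∀ k, n - 1 ≤ k → k ≤ n + 1 → r / w (k - 1) ≤ r / w (n - 2) := by
      intro k hk1 hk2
      refine div_le_div_of_nonneg_left hr.le hwn2 ?_
      rcases (show k = n - 1 ∨ k = n ∨ k = n + 1 by omega) with rfl | rfl | rfl
      · rw [show n - 1 - 1 = n - 2 by ring]
      · linarith
      · rw [show n + 1 - 1 = n by ring]; linarith
    refine finish (Amax := (A_hi + 2) * (r / w (n - 2))) (Dmax := r / w (n - 2)) (Γx := Γc) hΓc0
      (by linarith) ?_ (fun k hk1 hk2 => by rw [hD k]; exact hDk k hk1 hk2) ?_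
    · intro k hk1 hk2
      have h1 := hA_hi k (by linarith)
      have h2 := hDk k hk1 hk2
      calc A k ≤ A₀ k + 2 * D k := hAle k
        _ ≤ A_hi * (r / w (k - 1)) + 2 * (r / w (k - 1)) := by rw [hD k]; linarith
        _ = (A_hi + 2) * (r / w (k - 1)) := by ring
        _ ≤ (A_hi + 2) * (r / w (n - 2)) := mul_le_mul_of_nonneg_left h2 (by positivity)
    · -- q^{5n/2} (A_hi+2) (r/w(n-2))² ≤ (A_hi+2) C₄ · r / w(n-1)  ⟸  H4b at k = n - 2
      have hH := hH4b (n - 2) (by linarith)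
      have heq1 : q ^ ((5 : ℝ) * (((n - 2 : ℤ) : ℝ) + 2) / 2) = q ^ ((5 : ℝ) * n / 2) := by
        push_cast; ring_nf
      rw [heq1, show n - 2 + 1 = n - 1 by ring] at hH
      rw [hD n]
      -- rearrange
      have hkey : q ^ ((5 : ℝ) * n / 2) * (r / w (n - 2)) * (r / w (n - 2)) ≤ C₄ * (r / w (n - 1)) := by
        have e1 : q ^ ((5 : ℝ) * n / 2) * (r / w (n - 2)) * (r / w (n - 2)) =
            (q ^ ((5 : ℝ) * n / 2) * r * r) / (w (n - 2) ^ 2) := by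
          field_simp
        have e2 : C₄ * (r / w (n - 1)) = (C₄ * r) / w (n - 1) := by ring
        rw [e1, e2, div_le_div_iff₀ (pow_pos hwn2 2) hwn1]
        calc q ^ ((5 : ℝ) * n / 2) * r * r * w (n - 1) = (q ^ ((5 : ℝ) * n / 2) * r * w (n - 1)) * r := by ring
          _ ≤ (C₄ * w (n - 2) ^ 2) * r := mul_le_mul_of_nonneg_right hH hr.le
          _ = C₄ * r * w (n - 2) ^ 2 := by ring
      calc q ^ ((5 : ℝ) * n / 2) * ((A_hi + 2) * (r / w (n - 2))) * (r / w (n - 2))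
          = (A_hi + 2) * (q ^ ((5 : ℝ) * n / 2) * (r / w (n - 2)) * (r / w (n - 2))) := by ring
        _ ≤ (A_hi + 2) * (C₄ * (r / w (n - 1))) := mul_le_mul_of_nonneg_left hkey (by positivity)
        _ = Γc * (r / w (n - 1)) := by simp only [hΓc]; ring

end GappedFrontRobustOn

end Summit.NavierStokesRegularity.NavierStokesRegularity.Theorems

end
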